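import Summits.AtomisticToContinuum.Crystallization.Theorems.HullExactificationCascadeHullExactShellsShells
import Literature.MathematicalPhysics.StatisticalMechanics.BarlowStacking

/-!
# `SpectralChargeLedger.ShellsToLayers` (stmt-AtomisticToContinuum-17254), line `blowup-slot-layering` —
# stub S1 `stub_goodOfLimit`: two-letter shell congruence passes to local limits

Helper file for the crux `ShellsToLayers` of route `SpectralChargeLedger` (supports
stmt-AtomisticToContinuum-17254; proves the registered stub `stub_goodOfLimit` of the line
`Cruxes/ShellsToLayers/Lines/blowup_slot_layering.lean` verbatim, as `stub_goodOfLimit`).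

* `barlowShell_finite` — the punctured open `r`-shell of the origin in a Barlow stacking is finite
  (the stacking is `min a h`-separated, `le_dist_of_mem_barlowStacking`);
* `inBox_bounds` — on the parameter box `47/50 ≤ a₀ ≤ 1`, `|h₀ − a₀√(2/3)| ≤ a₀/100`:
  `0 < a₀` and `0.806·a₀ ≤ h₀ ≤ 0.827·a₀`;
* `good_of_limit_two` — **shell congruence with one of TWO finite patterns passes to local limits**:
  if `Y_k → Y` locally (two-way `ε`-matching on every ball about `0`, eventually), all sets are
  `δ`-separated, both patterns consist of points of norm `< r`, and the points of `Y_k` of norm `≤ ρ_k`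
  (`ρ_k → ∞`) have `r`-shells `τ_k`-congruent (linear isometry + bijection) to `P₁` OR to `P₂` with
  `τ_k → 0`, then every point of `Y` has an `η`-congruent shell (to `P₁` or to `P₂`) for every
  `η > 0`. The proof is that of the landed single-pattern `HullExactShells.good_of_limit`
  (margins `exists_margin_norm` / `exists_margin_dist`, a good index, the partner `y'` of the point,
  `exists_matching_equiv`, `good_transfer`); the conclusion inherits the letter of `y'`;
* `stub_goodOfLimit` — the registered stub: `P₁`, `P₂` the punctured open `13/10·a₀`-shells of the origin
  in `hcpStacking a₀ h₀` / `fccStacking a₀ h₀`.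

All `[folklore]` (Baake–Grimm 2013, Remark 5.6: local rubber topology). No definitions.
-/

noncomputable section

namespace Summit.AtomisticToContinuum.Crystallization.Theorems.ShellsToLayers

open scoped Topology
open Filter Metric
open Literature.MathematicalPhysics.StatisticalMechanics
open Summit.AtomisticToContinuum.Crystallization.Theorems.HullExactShells

/-- The punctured open `r`-shell of the origin in a Barlow stacking with `0 < a`, `0 < h` is finite
(the stacking is `min a h`-separated). [folklore] -/
theorem barlowShell_finite {a h : ℝ} (ha : 0 < a) (hh : 0 < h) (s : ℤ → ℤ) (r : ℝ) :
    {q : EuclideanSpace ℝ (Fin 3) | q ∈ barlowStacking a h s ∧ q ≠ 0 ∧ ‖q‖ < r}.Finite :=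
  finite_of_forall_le_dist_of_subset_closedBall (lt_min ha hh)
    (fun _ hp _ hq hpq => le_dist_of_mem_barlowStacking a h s ha.le hh.le hp.1 hq.1 hpq)
    (c := 0) (R := r) fun _ hq => mem_closedBall_zero_iff.2 hq.2.2.le

/-- On the parameter box: `0 < a₀` and `0.806·a₀ ≤ h₀ ≤ 0.827·a₀` (from
`0.8164 < √(2/3) < 0.8166`). [folklore] -/
theorem inBox_bounds {a₀ h₀ : ℝ} (ha : 47 / 50 ≤ a₀) (hh : |h₀ - a₀ * Real.sqrt (2 / 3)| ≤ a₀ / 100) :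
    0 < a₀ ∧ 806 / 1000 * a₀ ≤ h₀ ∧ h₀ ≤ 827 / 1000 * a₀ := by
  have hl : (8164 / 10000 : ℝ) < Real.sqrt (2 / 3) := by
    rw [Real.lt_sqrt (by norm_num)]; norm_num
  have hu : Real.sqrt (2 / 3) < 8166 / 10000 := by
    rw [Real.sqrt_lt' (by norm_num)]; norm_num
  obtain ⟨h1, h2⟩ := abs_le.1 hh
  refine ⟨by linarith, ?_, ?_⟩ <;> nlinarith

/-- **Shell congruence with one of two finite patterns passes to local limits** (two-letter twin of
`HullExactShells.good_of_limit`). [folklore] -/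
theorem good_of_limit_two {Ys : ℕ → Set (EuclideanSpace ℝ (Fin 3))}
    {Y P₁ P₂ : Set (EuclideanSpace ℝ (Fin 3))} {δ r : ℝ} {τ ρ : ℕ → ℝ} (hδ : 0 < δ) (hr : 0 < r)
    (hP₁ : P₁.Finite) (hP₂ : P₂.Finite) (hP₁r : ∀ q ∈ P₁, ‖q‖ < r) (hP₂r : ∀ q ∈ P₂, ‖q‖ < r)
    (hsep : ∀ k : ℕ, ∀ p ∈ Ys k, ∀ q ∈ Ys k, p ≠ q → δ ≤ dist p q)
    (hYsep : ∀ p ∈ Y, ∀ q ∈ Y, p ≠ q → δ ≤ dist p q)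
    (hgood : ∀ k : ℕ, ∀ q ∈ Ys k, ‖q‖ ≤ ρ k →
      ∃ A : EuclideanSpace ℝ (Fin 3) →ₗᵢ[ℝ] EuclideanSpace ℝ (Fin 3),
        (∃ e : ↥{z | z ∈ Ys k ∧ z ≠ q ∧ dist z q < r} ≃ ↥P₁,
          ∀ t : ↥{z | z ∈ Ys k ∧ z ≠ q ∧ dist z q < r},
            dist ((t : EuclideanSpace ℝ (Fin 3)) - q)
              (A ((e t : ↥P₁) : EuclideanSpace ℝ (Fin 3))) ≤ τ k) ∨
        (∃ e : ↥{z | z ∈ Ys k ∧ z ≠ q ∧ dist z q < r} ≃ ↥P₂,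
          ∀ t : ↥{z | z ∈ Ys k ∧ z ≠ q ∧ dist z q < r},
            dist ((t : EuclideanSpace ℝ (Fin 3)) - q)
              (A ((e t : ↥P₂) : EuclideanSpace ℝ (Fin 3))) ≤ τ k))
    (hτ : Tendsto τ atTop (𝓝 0)) (hρ : Tendsto ρ atTop atTop)
    (hlim : ∀ R ε : ℝ, 0 < ε → ∀ᶠ k : ℕ in atTop, BallMatch ε R 0 (Ys k) Y)
    {p : EuclideanSpace ℝ (Fin 3)} (hp : p ∈ Y) {η : ℝ} (hη : 0 < η) :
    ∃ A : EuclideanSpace ℝ (Fin 3) →ₗᵢ[ℝ] EuclideanSpace ℝ (Fin 3),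
      (∃ e : ↥{z | z ∈ Y ∧ z ≠ p ∧ dist z p < r} ≃ ↥P₁,
        ∀ t : ↥{z | z ∈ Y ∧ z ≠ p ∧ dist z p < r},
          dist ((t : EuclideanSpace ℝ (Fin 3)) - p)
            (A ((e t : ↥P₁) : EuclideanSpace ℝ (Fin 3))) ≤ η) ∨
      (∃ e : ↥{z | z ∈ Y ∧ z ≠ p ∧ dist z p < r} ≃ ↥P₂,
        ∀ t : ↥{z | z ∈ Y ∧ z ≠ p ∧ dist z p < r},
          dist ((t : EuclideanSpace ℝ (Fin 3)) - p)
            (A ((e t : ↥P₂) : EuclideanSpace ℝ (Fin 3))) ≤ η) := by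
  classical
  -- (1) margins: both patterns stay `m` inside the open cutoff, the limit shell `mT`
  obtain ⟨m₁, hm₁0, hm₁⟩ := exists_margin_norm hP₁ hr hP₁r
  obtain ⟨m₂, hm₂0, hm₂⟩ := exists_margin_norm hP₂ hr hP₂r
  set m : ℝ := min m₁ m₂ with hm_def
  have hm0 : 0 < m := lt_min hm₁0 hm₂0
  have hm₁' : ∀ q ∈ P₁, ‖q‖ + m ≤ r := fun q hq => by
    linarith [hm₁ q hq, min_le_left m₁ m₂]
  have hm₂' : ∀ q ∈ P₂, ‖q‖ + m ≤ r := fun q hq => by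
    linarith [hm₂ q hq, min_le_right m₁ m₂]
  have hTfin : ({z | z ∈ Y ∧ z ≠ p ∧ dist z p < r} : Set (EuclideanSpace ℝ (Fin 3))).Finite :=
    finite_of_forall_le_dist_of_subset_closedBall hδ
      (fun x hx y hy hxy => hYsep x hx.1 y hy.1 hxy) (c := p) (R := r)
      fun w hw => mem_closedBall.2 hw.2.2.le
  obtain ⟨mT, hmT0, hmT⟩ := exists_margin_dist hTfin hr fun t ht => ht.2.2
  -- (2) tolerances
  obtain ⟨η₁, hη₁0, hη₁η, hη₁m, -, -, -⟩ :=
    exists_pos_le_five (a := η / 2) (b := m / 2) (c := 1) (d := 1) (e := 1)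
      (by positivity) (by positivity) one_pos one_pos one_pos
  obtain ⟨ε, hε0, hεδ, hεT, hεm, hεη, hε1⟩ :=
    exists_pos_le_five (a := δ / 4) (b := mT / 4) (c := m / 8) (d := η / 8) (e := 1)
      (by positivity) (by positivity) (by positivity) (by positivity) one_pos
  have h2ε : 2 * ε < δ := by linarith
  -- (3) a good index: matched at radius `‖p‖ + r + 1`, tolerance `τ k ≤ η₁`, radius `ρ k ≥ ‖p‖ + 1`
  have hevτ : ∀ᶠ k : ℕ in atTop, τ k ≤ η₁ :=
    (Metric.tendsto_nhds.1 hτ η₁ hη₁0).mono fun k hk => by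
      rw [Real.dist_eq, sub_zero] at hk
      exact (le_abs_self _).trans hk.le
  have hevρ : ∀ᶠ k : ℕ in atTop, ‖p‖ + 1 ≤ ρ k := Filter.tendsto_atTop.1 hρ _
  obtain ⟨k, hkM, hkτ, hkρ⟩ := ((hlim (‖p‖ + r + 1) ε hε0).and (hevτ.and hevρ)).exists
  -- the partner `y'` of `p` and the congruence of its shell (its letter decides)
  obtain ⟨y', hy', hy'p⟩ := hkM.1 p hp (by rw [dist_zero_right]; linarith)
  have hy'n : ‖y'‖ ≤ ρ k := by linarith [norm_le_norm_add_dist y' p]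
  obtain ⟨A, hA⟩ := hgood k y' hy' hy'n
  have hTd : ∀ t ∈ Y, t ≠ p → dist t p < r → dist t p + 2 * ε < r := by
    intro t htY htp htr
    linarith [hmT t ⟨htY, htp, htr⟩]
  -- the shell of `y'` stays `2ε` inside the cutoff, whichever pattern it is matched to
  have hT'd : ∀ P : Set (EuclideanSpace ℝ (Fin 3)), (∀ q ∈ P, ‖q‖ + m ≤ r) →
      (∃ e : ↥{z | z ∈ Ys k ∧ z ≠ y' ∧ dist z y' < r} ≃ ↥P,
        ∀ t : ↥{z | z ∈ Ys k ∧ z ≠ y' ∧ dist z y' < r},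
          dist ((t : EuclideanSpace ℝ (Fin 3)) - y')
            (A ((e t : ↥P) : EuclideanSpace ℝ (Fin 3))) ≤ τ k) →
      ∀ t' ∈ Ys k, t' ≠ y' → dist t' y' < r → dist t' y' + 2 * ε < r := by
    intro P hPm hmatch t' ht'X ht'y ht'r
    obtain ⟨e', he'⟩ := hmatch
    have h1 := he' ⟨t', ht'X, ht'y, ht'r⟩
    have h2 := hPm _ (e' ⟨t', ht'X, ht'y, ht'r⟩).2
    have h4 : ‖t' - y'‖ ≤ ‖A ((e' ⟨t', ht'X, ht'y, ht'r⟩ : ↥P) : EuclideanSpace ℝ (Fin 3))‖ +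
        ‖t' - y' - A ((e' ⟨t', ht'X, ht'y, ht'r⟩ : ↥P) : EuclideanSpace ℝ (Fin 3))‖ := by
      linarith [norm_sub_norm_le (t' - y')
        (A ((e' ⟨t', ht'X, ht'y, ht'r⟩ : ↥P) : EuclideanSpace ℝ (Fin 3)))]
    rw [A.norm_map, ← dist_eq_norm, ← dist_eq_norm] at h4
    linarith
  -- (4) the matching bijection between the two shells, and transport — letter by letter
  rcases hA with hH | hF
  · obtain ⟨b, hbb⟩ :=
      exists_matching_equiv hYsep (hsep k) h2ε hε1 hkM hp hy' hy'p hTd (hT'd _ hm₁' hH)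
    obtain ⟨e', he'⟩ := hH
    obtain ⟨A', e, he⟩ := good_transfer (θ := 2 * ε) (η := η₁) (η' := η) b hbb
      ⟨A, e', fun t' => (he' t').trans hkτ⟩ (by linarith)
    exact ⟨A', Or.inl ⟨e, he⟩⟩
  · obtain ⟨b, hbb⟩ :=
      exists_matching_equiv hYsep (hsep k) h2ε hε1 hkM hp hy' hy'p hTd (hT'd _ hm₂' hF)
    obtain ⟨e', he'⟩ := hF
    obtain ⟨A', e, he⟩ := good_transfer (θ := 2 * ε) (η := η₁) (η' := η) b hbb
      ⟨A, e', fun t' => (he' t').trans hkτ⟩ (by linarith)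
    exact ⟨A', Or.inr ⟨e, he⟩⟩

/-- **Stub S1 of the line `blowup-slot-layering` (registered signature, verbatim): two-letter shell
congruence passes to local limits.** If `Y_k → Y` locally, all sets are `δ`-separated, and the points
of `Y_k` of norm `≤ ρ_k → ∞` are `τ_k`-good (hcp- or fcc-matched `13/10·a₀`-shells at scale `(a₀, h₀)`)
with `τ_k → 0`, then every point of `Y` is `η`-good for every `η > 0`. [folklore] -/
theorem stub_goodOfLimit : ∀ (a₀ h₀ δ : ℝ), 47 / 50 ≤ a₀ → a₀ ≤ 1 → |h₀ - a₀ * Real.sqrt (2 / 3)| ≤ a₀ / 100 → 0 < δ → ∀ (Ys : ℕ → Set (EuclideanSpace ℝ (Fin 3))) (Y : Set (EuclideanSpace ℝ (Fin 3))) (τ ρ : ℕ → ℝ), (∀ k : ℕ, ∀ p ∈ Ys k, ∀ q ∈ Ys k, p ≠ q → δ ≤ dist p q) → (∀ p ∈ Y, ∀ q ∈ Y, p ≠ q → δ ≤ dist p q) → (∀ k : ℕ, ∀ q ∈ Ys k, ‖q‖ ≤ ρ k → (∃ A : EuclideanSpace ℝ (Fin 3) →ₗᵢ[ℝ] EuclideanSpace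 ℝ (Fin 3), (∃ e : ↥{z : EuclideanSpace ℝ (Fin 3) | z ∈ Ys k ∧ z ≠ q ∧ dist z q < 13 / 10 * a₀} ≃ ↥{q : EuclideanSpace ℝ (Fin 3) | q ∈ Literature.MathematicalPhysics.StatisticalMechanics.hcpStacking a₀ h₀ ∧ q ≠ 0 ∧ ‖q‖ < 13 / 10 * a₀}, ∀ t : ↥{z : EuclideanSpace ℝ (Fin 3) | z ∈ Ys k ∧ z ≠ q ∧ dist z q < 13 / 10 * a₀}, dist ((t : EuclideanSpace ℝ (Fin 3)) - q) (A ((e t : ↥{q : EuclideanSpace ℝ (Fin 3) | q ∈ Literature.MathematicalPhysics.StatisticalMechanics.hcpStacking a₀ h₀ ∧ q ≠ 0 ∧ ‖q‖ < 13 / 10 * a₀}) : EuclideanSpace ℝ (Fin 3))) ≤ τ k) ∨ (∃ e : ↥{z : EuclideanSpace ℝ (Fin 3) | z ∈ Ys k ∧ z ≠ q ∧ dist z q < 13 / 10 * a₀} ≃ ↥{q : EuclideanSpace ℝ (Fin 3) | q ∈ Literature.MathematicalPhysics.StatisticalMechanics.fccStacking a₀ h₀ ∧ q ≠ 0 ∧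 ‖q‖ < 13 / 10 * a₀}, ∀ t : ↥{z : EuclideanSpace ℝ (Fin 3) | z ∈ Ys k ∧ z ≠ q ∧ dist z q < 13 / 10 * a₀}, dist ((t : EuclideanSpace ℝ (Fin 3)) - q) (A ((e t : ↥{q : EuclideanSpace ℝ (Fin 3) | q ∈ Literature.MathematicalPhysics.StatisticalMechanics.fccStacking a₀ h₀ ∧ q ≠ 0 ∧ ‖q‖ < 13 / 10 * a₀}) : EuclideanSpace ℝ (Fin 3))) ≤ τ k))) → Filter.Tendsto τ Filter.atTop (nhds 0) → Filter.Tendsto ρ Filter.atTop Filter.atTop → (∀ R ε : ℝ, 0 < ε → ∀ᶠ k : ℕ in Filter.atTop, Literature.MathematicalPhysics.StatisticalMechanics.BallMatch ε R 0 (Ys k) Y) → ∀ p ∈ Y, ∀ η : ℝ, 0 < η → (∃ A : EuclideanSpace ℝ (Fin 3) →ₗᵢ[ℝ] EuclideanSpace ℝ (Fin 3), (∃ e : ↥{z : EuclideanSpace ℝ (Fin 3) | z ∈ Y ∧ z ≠ p ∧ dist z p < 13 / 10 * a₀} ≃ ↥{q : EuclideanSpace ℝ (Fin 3) | q ∈ Literature.MathematicalPhysics.StatisticalMechanics.hcpStacking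 a₀ h₀ ∧ q ≠ 0 ∧ ‖q‖ < 13 / 10 * a₀}, ∀ t : ↥{z : EuclideanSpace ℝ (Fin 3) | z ∈ Y ∧ z ≠ p ∧ dist z p < 13 / 10 * a₀}, dist ((t : EuclideanSpace ℝ (Fin 3)) - p) (A ((e t : ↥{q : EuclideanSpace ℝ (Fin 3) | q ∈ Literature.MathematicalPhysics.StatisticalMechanics.hcpStacking a₀ h₀ ∧ q ≠ 0 ∧ ‖q‖ < 13 / 10 * a₀}) : EuclideanSpace ℝ (Fin 3))) ≤ η) ∨ (∃ e : ↥{z : EuclideanSpace ℝ (Fin 3) | z ∈ Y ∧ z ≠ p ∧ dist z p < 13 / 10 * a₀} ≃ ↥{q : EuclideanSpace ℝ (Fin 3) | q ∈ Literature.MathematicalPhysics.StatisticalMechanics.fccStacking a₀ h₀ ∧ q ≠ 0 ∧ ‖q‖ < 13 / 10 * a₀}, ∀ t : ↥{z : EuclideanSpace ℝ (Fin 3) | z ∈ Y ∧ z ≠ p ∧ dist z p < 13 / 10 * a₀}, dist ((t : EuclideanSpace ℝ (Fin 3)) - p) (A ((e t : ↥{q : EuclideanSpace ℝ (Fin 3)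 | q ∈ Literature.MathematicalPhysics.StatisticalMechanics.fccStacking a₀ h₀ ∧ q ≠ 0 ∧ ‖q‖ < 13 / 10 * a₀}) : EuclideanSpace ℝ (Fin 3))) ≤ η)) := by
  intro a₀ h₀ δ ha _ hh hδ Ys Y τ ρ hsep hYsep hgood hτ hρ hlim p hp η hη
  obtain ⟨ha0, hlo, -⟩ := inBox_bounds ha hh
  have hh0 : 0 < h₀ := by linarith
  have hr : (0 : ℝ) < 13 / 10 * a₀ := by positivity
  have hP₁ : ({q : EuclideanSpace ℝ (Fin 3) |
      q ∈ hcpStacking a₀ h₀ ∧ q ≠ 0 ∧ ‖q‖ < 13 / 10 * a₀}).Finite :=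
    barlowShell_finite ha0 hh0 alternatingHagg _
  have hP₂ : ({q : EuclideanSpace ℝ (Fin 3) |
      q ∈ fccStacking a₀ h₀ ∧ q ≠ 0 ∧ ‖q‖ < 13 / 10 * a₀}).Finite :=
    barlowShell_finite ha0 hh0 constHagg _
  exact good_of_limit_two hδ hr hP₁ hP₂ (fun q hq => hq.2.2) (fun q hq => hq.2.2) hsep hYsep hgood
    hτ hρ hlim hp hη

end Summit.AtomisticToContinuum.Crystallization.Theorems.ShellsToLayers

end
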